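import Summits.CriticalPhenomena.SAWScalingLimit.Theorems.SAWLoopFugacityFlowIsingBoundaryRatioWindowCrossingDefs
import Summits.CriticalPhenomena.SAWScalingLimit.Theorems.SAWLoopFugacityFlowIsingBoundaryRatioSideCrossSeparation
import Summits.CriticalPhenomena.SAWScalingLimit.Theorems.SAWLoopFugacityFlowIsingBoundaryRatioHalfAnnulusSideCrossingBoundOf
import Summits.CriticalPhenomena.SAWScalingLimit.Theorems.SAWLoopFugacityFlowIsingBoundaryRatioWindowExtResistanceCells
import HarnessLib

/-!
# Radial crossings pass through the window rectangle — lattice and walk bookkeeping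
(line `fk-anchor-transfer`, crux `IsingBoundaryRatio`, stmt-CriticalPhenomena-10650; first helper module of the
proof of `AnnCrossThroughWindowRect`, file `…IsingBoundaryRatioAnnCrossThroughWindowRect.lean`)

Folklore bookkeeping on the cells of `δℤ²`, on walks, and on the vocabulary `DiscreteRect` of CDH16 rectangles:

* closed cells (cf. `wer_mem_closure_cell_floor` of `…WindowExtResistanceCells.lean`: every point lies in the closed
  cell of its integer parts): two points of one closed cell are `≤ 2δ` apart, a closed lattice edge meeting a
  closed cell has an end at a corner of it (`exists_corner_of_mem_segment_of_mem_closure_cell`), two closed cells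
  sharing a point share a corner;
* `forall_of_path_cover` — a path covered by finitely many closed sets: a family of them containing one set met
  by the path and closed under "both meet the path at a common point" contains every set met by the path
  (connectedness of `[0, 1]`);
* walks: splitting at the first vertex / first dart with a property, the last dart;
* `DiscreteRect`: the ends of an edge are vertices.
-/

noncomputable section

open scoped Classical Topology
open Filter Set Metric SimpleGraph Complex
open Literature.Probability.LatticeModels Literature.Probability.RandomPlanarGeometry
open Literature.Probability.Percolation (BondConfig)
open Literature.Topology.PlaneTopology
open UpperHalfPlane (upperHalfPlaneSet)

namespace Summit.CriticalPhenomena.SAWScalingLimit.Theorems.IsingBoundaryRatio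

/-! ### Closed cells of `δℤ²` -/

/-- Coordinates of a point of a closed cell. [folklore] -/
theorem re_im_bounds_of_mem_closure_cell {δ : ℝ} (hδ : 0 < δ) {k j : ℤ} {z : ℂ}
    (hz : z ∈ closure (Mesh.cell δ k j)) :
    δ * k ≤ z.re ∧ z.re ≤ δ * (k + 1) ∧ δ * j ≤ z.im ∧ z.im ≤ δ * (j + 1) := by
  rw [Mesh.closure_cell hδ, mem_reProdIm] at hz
  exact ⟨hz.1.1, hz.1.2, hz.2.1, hz.2.2⟩

/-- Two points of one closed cell are at distance `≤ 2δ`. [folklore] -/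
theorem dist_le_of_mem_closure_cell {δ : ℝ} (hδ : 0 < δ) {k j : ℤ} {z w : ℂ}
    (hz : z ∈ closure (Mesh.cell δ k j)) (hw : w ∈ closure (Mesh.cell δ k j)) : dist z w ≤ 2 * δ := by
  obtain ⟨h1, h2, h3, h4⟩ := re_im_bounds_of_mem_closure_cell hδ hz
  obtain ⟨h5, h6, h7, h8⟩ := re_im_bounds_of_mem_closure_cell hδ hw
  rw [Complex.dist_eq]
  refine (norm_le_abs_re_add_abs_im _).trans ?_
  rw [sub_re, sub_im]
  have hre : |z.re - w.re| ≤ δ := by rw [abs_le]; constructor <;> linarith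
  have him : |z.im - w.im| ≤ δ := by rw [abs_le]; constructor <;> linarith
  linarith

/-- A lattice point in the closed cell `(k, j)` is one of its corners. [folklore] -/
theorem exists_eq_corner_of_bounds {k j : ℤ} {w : Site 2} (h0 : k ≤ w 0) (h0' : w 0 ≤ k + 1) (h1 : j ≤ w 1)
    (h1' : w 1 ≤ j + 1) : ∃ a b : Bool, w = Mesh.corner k j a b := by
  refine ⟨decide (w 0 = k + 1), decide (w 1 = j + 1), ?_⟩
  rw [Site.eq_iff_two, Mesh.corner_zero, Mesh.corner_one]
  constructor
  · by_cases h : w 0 = k + 1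
    · simp [h]
    · simp only [h, decide_false, Bool.false_eq_true, ↓reduceIte, add_zero]; omega
  · by_cases h : w 1 = j + 1
    · simp [h]
    · simp only [h, decide_false, Bool.false_eq_true, ↓reduceIte, add_zero]; omega

/-- **A closed lattice edge meeting a closed cell has an end at a corner of the cell.** [folklore] -/
theorem exists_corner_of_mem_segment_of_mem_closure_cell {δ : ℝ} (hδ : 0 < δ) {x y : Site 2}
    (hxy : (zdGraph 2).Adj x y) {z : ℂ} (hz : z ∈ segment ℝ (meshPoint δ x) (meshPoint δ y)) {k j : ℤ}
    (hz' : z ∈ closure (Mesh.cell δ k j)) :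
    ∃ (w : Site 2) (a b : Bool), (w = x ∨ w = y) ∧ w = Mesh.corner k j a b := by
  obtain ⟨s0, s0', s1, s1'⟩ := re_im_bounds_of_mem_segment hδ hz
  obtain ⟨c0, c0', c1, c1'⟩ := re_im_bounds_of_mem_closure_cell hδ hz'
  have d0 : ((min (x 0) (y 0) : ℤ) : ℝ) ≤ k + 1 := by push_cast; exact le_of_mul_le_mul_left (s0.trans c0') hδ
  have d0' : (k : ℝ) ≤ ((max (x 0) (y 0) : ℤ) : ℝ) := by push_cast; exact le_of_mul_le_mul_left (c0.trans s0') hδ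
  have d1 : ((min (x 1) (y 1) : ℤ) : ℝ) ≤ j + 1 := by push_cast; exact le_of_mul_le_mul_left (s1.trans c1') hδ
  have d1' : (j : ℝ) ≤ ((max (x 1) (y 1) : ℤ) : ℝ) := by push_cast; exact le_of_mul_le_mul_left (c1.trans s1') hδ
  have e0 : min (x 0) (y 0) ≤ k + 1 := by exact_mod_cast d0
  have e0' : k ≤ max (x 0) (y 0) := by exact_mod_cast d0'
  have e1 : min (x 1) (y 1) ≤ j + 1 := by exact_mod_cast d1
  have e1' : j ≤ max (x 1) (y 1) := by exact_mod_cast d1'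
  have key : ∃ w : Site 2, (w = x ∨ w = y) ∧ k ≤ w 0 ∧ w 0 ≤ k + 1 ∧ j ≤ w 1 ∧ w 1 ≤ j + 1 := by
    rw [Literature.Probability.Percolation.zdGraph_two_adj_iff] at hxy
    rcases hxy with ⟨h0, h1⟩ | ⟨h0, h1⟩ | ⟨h1, h0⟩ | ⟨h1, h0⟩
    · by_cases hk : k ≤ x 0
      · exact ⟨x, Or.inl rfl, hk, by omega, by omega, by omega⟩
      · exact ⟨y, Or.inr rfl, by omega, by omega, by omega, by omega⟩
    · by_cases hk : k ≤ y 0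
      · exact ⟨y, Or.inr rfl, hk, by omega, by omega, by omega⟩
      · exact ⟨x, Or.inl rfl, by omega, by omega, by omega, by omega⟩
    · by_cases hj : j ≤ x 1
      · exact ⟨x, Or.inl rfl, by omega, by omega, hj, by omega⟩
      · exact ⟨y, Or.inr rfl, by omega, by omega, by omega, by omega⟩
    · by_cases hj : j ≤ y 1
      · exact ⟨y, Or.inr rfl, by omega, by omega, hj, by omega⟩
      · exact ⟨x, Or.inl rfl, by omega, by omega, by omega, by omega⟩
  obtain ⟨w, hw, h0, h0', h1, h1'⟩ := key
  obtain ⟨a, b, hab⟩ := exists_eq_corner_of_bounds h0 h0' h1 h1'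
  exact ⟨w, a, b, hw, hab⟩

/-- **Two closed cells sharing a point share a corner.** [folklore] -/
theorem exists_corner_eq_of_mem_closure_cell {δ : ℝ} (hδ : 0 < δ) {k j k' j' : ℤ} {z : ℂ}
    (hz : z ∈ closure (Mesh.cell δ k j)) (hz' : z ∈ closure (Mesh.cell δ k' j')) :
    ∃ a b a' b' : Bool, Mesh.corner k j a b = Mesh.corner k' j' a' b' := by
  obtain ⟨c0, c0', c1, c1'⟩ := re_im_bounds_of_mem_closure_cell hδ hz
  obtain ⟨e0, e0', e1, e1'⟩ := re_im_bounds_of_mem_closure_cell hδ hz'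
  have f0 : (k : ℝ) ≤ k' + 1 := le_of_mul_le_mul_left (c0.trans e0') hδ
  have f0' : (k' : ℝ) ≤ k + 1 := le_of_mul_le_mul_left (e0.trans c0') hδ
  have f1 : (j : ℝ) ≤ j' + 1 := le_of_mul_le_mul_left (c1.trans e1') hδ
  have f1' : (j' : ℝ) ≤ j + 1 := le_of_mul_le_mul_left (e1.trans c1') hδ
  have g0 : k ≤ k' + 1 := by exact_mod_cast f0
  have g0' : k' ≤ k + 1 := by exact_mod_cast f0'
  have g1 : j ≤ j' + 1 := by exact_mod_cast f1
  have g1' : j' ≤ j + 1 := by exact_mod_cast f1'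
  set w : Site 2 := ![max k k', max j j'] with hw
  obtain ⟨a, b, hab⟩ := exists_eq_corner_of_bounds (k := k) (j := j) (w := w)
    (by simp [hw]) (by simp only [hw, Matrix.cons_val_zero]; omega)
    (by simp [hw]) (by simp only [hw, Matrix.cons_val_one, Matrix.cons_val_zero]; omega)
  obtain ⟨a', b', hab'⟩ := exists_eq_corner_of_bounds (k := k') (j := j') (w := w)
    (by simp [hw]) (by simp only [hw, Matrix.cons_val_zero]; omega)
    (by simp [hw]) (by simp only [hw, Matrix.cons_val_one, Matrix.cons_val_zero]; omega)
  exact ⟨a, b, a', b', hab.symm.trans hab'⟩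

/-- A cell whose closure lies in `Ω` is perfect. [folklore] -/
theorem isPerfect_of_closure_cell_subset {Ω : Set ℂ} {δ : ℝ} (hδ : 0 < δ) {k j : ℤ}
    (h : closure (Mesh.cell δ k j) ⊆ Ω) : Mesh.IsPerfect Ω δ k j :=
  ⟨subset_closure.trans h, fun a b => h (Mesh.meshPoint_corner_mem_closure_cell hδ k j a b)⟩

/-- The indices of a perfect cell of a domain inside `closedBall 0 R` are bounded by `⌈R / δ⌉`. [folklore] -/
theorem mem_box_of_isPerfect {Ω : Set ℂ} {δ R : ℝ} (hδ : 0 < δ) (hR : Ω ⊆ closedBall (0 : ℂ) R) {k j : ℤ}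
    (h : Mesh.IsPerfect Ω δ k j) :
    (k, j) ∈ Finset.Icc (-⌈R / δ⌉) ⌈R / δ⌉ ×ˢ Finset.Icc (-⌈R / δ⌉) ⌈R / δ⌉ := by
  have hc : meshPoint δ (Mesh.corner k j false false) ∈ closedBall (0 : ℂ) R := hR (h.2 false false)
  rw [mem_closedBall, dist_zero_right] at hc
  have hre := (abs_re_le_norm _).trans hc
  have him := (abs_im_le_norm _).trans hc
  simp only [meshPoint_re, meshPoint_im, Mesh.corner_zero, Mesh.corner_one, Bool.false_eq_true, ↓reduceIte,
    add_zero, abs_mul, abs_of_pos hδ] at hre him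
  have key : ∀ a : ℤ, δ * |(a : ℝ)| ≤ R → a ∈ Finset.Icc (-⌈R / δ⌉) ⌈R / δ⌉ := fun a ha => by
    have ha' : |(a : ℝ)| ≤ R / δ := by rwa [le_div_iff₀ hδ, mul_comm]
    obtain ⟨h1, h2⟩ := abs_le.1 ha'
    rw [Finset.mem_Icc]
    constructor
    · have : (-a : ℝ) ≤ ⌈R / δ⌉ := (neg_le.1 h1).trans (Int.le_ceil _)
      have : ((-a : ℤ) : ℝ) ≤ ⌈R / δ⌉ := by push_cast; exact this
      have := Int.cast_le.1 this
      omega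
    · exact Int.cast_le.1 (h2.trans (Int.le_ceil _))
  exact Finset.mem_product.2 ⟨key k hre, key j him⟩

/-! ### Paths covered by finitely many closed sets -/

/-- **Propagation along a covered path.** If the range of a path is covered by finitely many closed sets
`C i`, `i ∈ 𝒞`, and a family `S` contains some index whose set meets the path and contains, with any index of
`𝒞` in `S`, every index of `𝒞` whose set meets the former's set on the path, then `S` contains every index of
`𝒞` whose set meets the path (the parameter interval is connected). [folklore] -/
theorem forall_of_path_cover {ι : Type*} {x y : ℂ} (γ : Path x y) (𝒞 : Finset ι) (C : ι → Set ℂ)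
    (hC : ∀ i ∈ 𝒞, IsClosed (C i)) (hcov : range γ ⊆ ⋃ i ∈ 𝒞, C i) (S : Set ι)
    (h0 : ∃ i ∈ 𝒞, i ∈ S ∧ (C i ∩ range γ).Nonempty)
    (hstep : ∀ i ∈ 𝒞, i ∈ S → ∀ i' ∈ 𝒞, (C i ∩ C i' ∩ range γ).Nonempty → i' ∈ S) :
    ∀ i ∈ 𝒞, (C i ∩ range γ).Nonempty → i ∈ S := by
  by_contra hcon
  push Not at hcon
  obtain ⟨i₁, hi₁, ⟨z₁, hz₁C, hz₁γ⟩, hi₁S⟩ := hcon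
  set T₁ : Set ℝ := ⋃ i ∈ 𝒞.filter (fun i => i ∈ S), γ.extend ⁻¹' C i with hT₁
  set T₂ : Set ℝ := ⋃ i ∈ 𝒞.filter (fun i => i ∉ S), γ.extend ⁻¹' C i with hT₂
  have hT₁c : IsClosed T₁ := isClosed_biUnion_finset fun i hi =>
    (hC i (Finset.mem_filter.1 hi).1).preimage γ.continuous_extend
  have hT₂c : IsClosed T₂ := isClosed_biUnion_finset fun i hi =>
    (hC i (Finset.mem_filter.1 hi).1).preimage γ.continuous_extend
  have hext : ∀ t : ℝ, γ.extend t ∈ range γ := fun t => by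
    rw [← Path.extend_range]; exact mem_range_self t
  have hpar : ∀ z ∈ range γ, ∃ t ∈ Icc (0 : ℝ) 1, γ.extend t = z := by
    rintro z ⟨t, rfl⟩
    exact ⟨t, t.2, Path.extend_extends' γ t⟩
  have hcover : Icc (0 : ℝ) 1 ⊆ T₁ ∪ T₂ := by
    intro t _
    obtain ⟨i, hi, hti⟩ := mem_iUnion₂.1 (hcov (hext t))
    by_cases hiS : i ∈ S
    · exact Or.inl (mem_iUnion₂.2 ⟨i, Finset.mem_filter.2 ⟨hi, hiS⟩, hti⟩)
    · exact Or.inr (mem_iUnion₂.2 ⟨i, Finset.mem_filter.2 ⟨hi, hiS⟩, hti⟩)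
  have hne₁ : (Icc (0 : ℝ) 1 ∩ T₁).Nonempty := by
    obtain ⟨i₀, hi₀, hi₀S, z₀, hz₀C, hz₀γ⟩ := h0
    obtain ⟨t, ht, htz⟩ := hpar z₀ hz₀γ
    exact ⟨t, ht, mem_iUnion₂.2 ⟨i₀, Finset.mem_filter.2 ⟨hi₀, hi₀S⟩, by rw [mem_preimage, htz]; exact hz₀C⟩⟩
  have hne₂ : (Icc (0 : ℝ) 1 ∩ T₂).Nonempty := by
    obtain ⟨t, ht, htz⟩ := hpar z₁ hz₁γ
    exact ⟨t, ht, mem_iUnion₂.2 ⟨i₁, Finset.mem_filter.2 ⟨hi₁, hi₁S⟩, by rw [mem_preimage, htz]; exact hz₁C⟩⟩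
  obtain ⟨t, -, ht₁, ht₂⟩ := isPreconnected_closed_iff.1 isPreconnected_Icc T₁ T₂ hT₁c hT₂c hcover hne₁ hne₂
  obtain ⟨i, hi, hti⟩ := mem_iUnion₂.1 ht₁
  obtain ⟨i', hi', hti'⟩ := mem_iUnion₂.1 ht₂
  rw [Finset.mem_filter] at hi hi'
  exact hi'.2 (hstep i hi.1 hi.2 i' hi'.1 ⟨γ.extend t, ⟨hti, hti'⟩, hext t⟩)

/-! ### Walks: splitting at the first vertex or dart with a property -/

/-- **Splitting a walk at its first vertex satisfying `P`** (the end satisfies `P`): the darts of the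
prefix start off `P`. [folklore] -/
theorem exists_split_first_vertex {V : Type*} {G : SimpleGraph V} (P : V → Prop) {u v : V} (p : G.Walk u v)
    (hv : P v) : ∃ (w : V) (q₁ : G.Walk u w) (q₂ : G.Walk w v),
      P w ∧ (∀ d ∈ q₁.darts, ¬ P d.fst) ∧ q₁.append q₂ = p := by
  induction p with
  | nil => exact ⟨_, .nil, .nil, hv, by simp, rfl⟩
  | @cons a b c h p' ih =>
    by_cases ha : P a
    · exact ⟨a, .nil, .cons h p', ha, by simp, rfl⟩
    · obtain ⟨w, q₁, q₂, hw, hd, heq⟩ := ih hv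
      refine ⟨w, .cons h q₁, q₂, hw, fun d hd' => ?_, by rw [Walk.cons_append, heq]⟩
      rw [Walk.darts_cons, List.mem_cons] at hd'
      rcases hd' with rfl | hd'
      exacts [ha, hd d hd']

/-- **Splitting a walk at its first dart off `P`** (some dart is off `P`). [folklore] -/
theorem exists_split_first_dart {V : Type*} {G : SimpleGraph V} (P : G.Dart → Prop) {u v : V} (p : G.Walk u v)
    (hp : ∃ d ∈ p.darts, ¬ P d) : ∃ (w w' : V) (q₁ : G.Walk u w) (h : G.Adj w w') (q₂ : G.Walk w' v),
      (∀ d ∈ q₁.darts, P d) ∧ ¬ P ⟨(w, w'), h⟩ ∧ q₁.append (Walk.cons h q₂) = p := by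
  induction p with
  | nil => simp at hp
  | @cons a b c h p' ih =>
    by_cases hab : P ⟨(a, b), h⟩
    · have hp' : ∃ d ∈ p'.darts, ¬ P d := by
        obtain ⟨d, hd, hPd⟩ := hp
        rw [Walk.darts_cons, List.mem_cons] at hd
        rcases hd with rfl | hd
        · exact absurd hab hPd
        · exact ⟨d, hd, hPd⟩
      obtain ⟨w, w', q₁, h', q₂, h1, h2, heq⟩ := ih hp'
      refine ⟨w, w', .cons h q₁, h', q₂, fun d hd => ?_, h2, by rw [Walk.cons_append, heq]⟩
      rw [Walk.darts_cons, List.mem_cons] at hd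
      rcases hd with rfl | hd
      exacts [hab, h1 d hd]
    · exact ⟨a, b, .nil, h, p', by simp, hab, rfl⟩

/-- A walk of positive length has a dart ending at its end vertex. [folklore] -/
theorem exists_dart_snd_eq {V : Type*} {G : SimpleGraph V} {u v : V} (p : G.Walk u v) (hp : 0 < p.length) :
    ∃ d ∈ p.darts, d.snd = v := by
  induction p with
  | nil => simp at hp
  | @cons a b c h p' ih =>
    rcases Nat.eq_zero_or_pos p'.length with h0 | h0
    · have hbc : b = c := Walk.eq_of_length_eq_zero h0
      subst hbc
      exact ⟨⟨(a, b), h⟩, by simp, rfl⟩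
    · obtain ⟨d, hd, hdc⟩ := ih h0
      exact ⟨d, by simp [hd], hdc⟩

/-- The first dart of a walk of positive length starts at its start vertex. [folklore] -/
theorem exists_dart_fst_eq {V : Type*} {G : SimpleGraph V} {u v : V} (p : G.Walk u v) (hp : 0 < p.length) :
    ∃ d ∈ p.darts, d.fst = u := by
  cases p with
  | nil => simp at hp
  | cons h p' => exact ⟨⟨(_, _), h⟩, by simp, rfl⟩

/-- A decomposition `q₁ ++ q₂` of a walk `cons h p` with `q₁` of positive length starts with the same
dart. [folklore] -/
theorem exists_eq_cons_of_append_eq_cons {V : Type*} {G : SimpleGraph V} {x y w v : V} {h : G.Adj x y}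
    {p : G.Walk y v} : ∀ (q₁ : G.Walk x w) (q₂ : G.Walk w v), q₁.append q₂ = Walk.cons h p → 0 < q₁.length →
      ∃ q₁' : G.Walk y w, q₁ = Walk.cons h q₁' ∧ q₁'.append q₂ = p
  | .nil, _, _, hl => by simp at hl
  | .cons h' q₁', q₂, heq, _ => by
    rw [Walk.cons_append] at heq
    obtain ⟨rfl, heq'⟩ := Walk.cons.inj heq
    exact ⟨q₁', rfl, eq_of_heq heq'⟩

/-- A vertex of a walk is the start vertex or the end of a dart. [folklore] -/
theorem eq_or_exists_dart_snd_of_mem_support {V : Type*} {G : SimpleGraph V} {u v : V} (p : G.Walk u v) {z : V}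
    (hz : z ∈ p.support) : z = u ∨ ∃ d ∈ p.darts, d.snd = z := by
  rw [← Walk.cons_tail_support, List.mem_cons, ← Walk.map_snd_darts, List.mem_map] at hz
  exact hz

/-! ### `DiscreteRect` bookkeeping -/

/-- The ends of an edge of a discrete domain are vertices of it (`mem_verts_iff` of
`…IsingBoundaryRatioHalfAnnulusSideCrossingBoundOf.lean`). [folklore] -/
theorem mem_verts_of_mem {E : Finset (Sym2 (Site 2))} {x y : Site 2} (h : s(x, y) ∈ E) :
    x ∈ DiscreteRect.verts E ∧ y ∈ DiscreteRect.verts E :=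
  ⟨mem_verts_iff.2 ⟨_, h, Sym2.mem_mk_left x y⟩, mem_verts_iff.2 ⟨_, h, Sym2.mem_mk_right x y⟩⟩

/-- A closed lattice edge meeting a closed cell has an end at a corner of the cell, closed form (registered
sub-goal of stmt-CriticalPhenomena-10650). [folklore] -/
theorem exists_corner_of_mem_segment_of_mem_closure_cell' : ∀ {δ : ℝ}, 0 < δ → ∀ {x y : Site 2}, (zdGraph 2).Adj x y → ∀ {z : ℂ}, z ∈ segment ℝ (meshPoint δ x) (meshPoint δ y) → ∀ {k j : ℤ}, z ∈ closure (Mesh.cell δ k j) → ∃ (w : Site 2) (a b : Bool), (w = x ∨ w = y) ∧ w = Mesh.corner k j a b :=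
  fun hδ _ _ hxy _ hz _ _ hz' => exists_corner_of_mem_segment_of_mem_closure_cell hδ hxy hz hz'

end Summit.CriticalPhenomena.SAWScalingLimit.Theorems.IsingBoundaryRatio

end
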